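import Summits.FinalStateConjecture.FinalStateConjecture.Theorems.BartnikGapSettlingSettledCaptureCrushDefs
import Summits.FinalStateConjecture.FinalStateConjecture.Theorems.BartnikGapSettlingGapExhaustionInjectiveMfderivOfClose
import HarnessLib

/-!
# Crux `SettledCapture` (stmt-FinalStateConjecture-17328), line `null-concave-crush`:
# an `η`-good interior chart is an IMMERSION on its late shell (brick of stub 3a `stub_chartNullGeodesic`)

Route `BartnikGapSettling`; helper (`--supports stmt-FinalStateConjecture-17328`, registered sub-goal
`stub_crushChartImmersion`) for the registered stub `stub_chartNullGeodesic` (manifold plumbing of the crush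
transport) of the checked skeleton `Cruxes/SettledCapture/Lines/null_concave_crush.lean` (rev 5).

* `crush_boostedKerr_coercive` — the boosted Kerr–Schild forms `boostedKerrBilin Λ c M a y` are uniformly
  coercive, `β‖v‖ ≤ ‖g_B(y) v‖`, on every rest-frame radial band `0 < r_lo ≤ r(Λ⁻¹(y − c)) ≤ r_hi` (all times):
  the unboosted band coercivity (`stub_injective_mfderiv_of_close`, crux `GapExhaustion`) transported through
  `g_B(y)(v, w) = g_{M,a}(Λ⁻¹(y − c))(Λ⁻¹v, Λ⁻¹w)` at the cost of `‖Λ‖²`;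
* `stub_crushChartImmersion` — for `η ≤ η₁(M, a, δ, mo) := β/2` an `η`-good interior chart
  (`IsGoodInteriorChart`, `supCkENorm (val '' shell) 1 (deviationExtend) ≤ η`) has, at every point of the late shell
  `{t* > T, r₋ + δ/2 < r < r₊}`, metric deviation of norm `≤ η.toReal < β` and hence INJECTIVE DIFFERENTIAL
  (`injClose_nondegenerate_of_norm_sub_lt`: a `dΦ_x v = 0` would make `v` `(Φ^*g)_x`-orthogonal to everything).

References: O'Neill 1983, Ch. 3, Def. 3.9 (pull-back); Kerr–Schild 1965, §2 (nondegeneracy, stationarity).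
-/

noncomputable section

-- instance search through the nested operator types `E4 →L[ℝ] E4 →L[ℝ] ℝ`
set_option maxSynthPendingDepth 3

-- D-0017: single-problem summit, `Summit.<S>.<S>.…` by design (cf. lakefile `weak.linter.dupNamespace`).
set_option linter.dupNamespace false

namespace Summit.FinalStateConjecture.FinalStateConjecture.Theorems.BartnikGapSettling.SettledCapture

open Set Filter Function TopologicalSpace
open scoped Manifold ContDiff Topology ENNReal
open Literature.Geometry.Lorentzian
open Summit.FinalStateConjecture.FinalStateConjecture.Theorems

/-! ### Coercivity of the boosted Kerr–Schild forms -/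

/-- `g_B(y) v = (g_{M,a}(Λ⁻¹(y − c)) (Λ⁻¹ v)) ∘ Λ⁻¹` as a covector. [folklore] -/
theorem crush_boostedKerrBilin_apply_eq_comp (mo : lorentzGroup × E4) (M a : ℝ) (y v : E4) :
    boostedKerrBilin mo.1 mo.2 M a y v =
      (Kerr.bilin M a (poincareInv mo.1 mo.2 y) ((mo.1 : E4 ≃L[ℝ] E4).symm v)).comp
        ((mo.1 : E4 ≃L[ℝ] E4).symm : E4 →L[ℝ] E4) := by
  ext w
  rw [boostedKerrBilin_apply]
  rfl

/-- **Uniform coercivity of the boosted Kerr–Schild forms on a rest-frame radial band** (all times):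
`β‖v‖ ≤ ‖boostedKerrBilin Λ c M a y v‖` whenever `r_lo ≤ r(Λ⁻¹(y − c)) ≤ r_hi`, `0 < r_lo ≤ r_hi`. From the
unboosted band coercivity and `‖K‖ ≤ ‖K ∘ Λ⁻¹‖‖Λ‖`, `‖v‖ ≤ ‖Λ‖‖Λ⁻¹v‖`. [folklore] -/
theorem crush_boostedKerr_coercive (M a : ℝ) (mo : lorentzGroup × E4) {r_lo r_hi : ℝ} (hlo : 0 < r_lo)
    (hle : r_lo ≤ r_hi) :
    ∃ β : ℝ, 0 < β ∧ ∀ y : E4, r_lo ≤ Kerr.radius a (poincareInv mo.1 mo.2 y) →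
      Kerr.radius a (poincareInv mo.1 mo.2 y) ≤ r_hi → ∀ v : E4, β * ‖v‖ ≤ ‖boostedKerrBilin mo.1 mo.2 M a y v‖ := by
  obtain ⟨β, hβ, hK⟩ := stub_injective_mfderiv_of_close.2 M a r_lo r_hi hlo hle
  set L : E4 →L[ℝ] E4 := ((mo.1 : E4 ≃L[ℝ] E4) : E4 →L[ℝ] E4) with hL
  set Li : E4 →L[ℝ] E4 := ((mo.1 : E4 ≃L[ℝ] E4).symm : E4 →L[ℝ] E4) with hLi
  -- `‖L‖ > 0` (an automorphism of a nontrivial space)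
  have hLpos : 0 < ‖L‖ := by
    rcases (norm_nonneg L).eq_or_lt with h0 | hpos
    · exfalso
      have hL0 : L = 0 := norm_eq_zero.1 h0.symm
      have h1 : L (E4.basisVector 0) = 0 := by rw [hL0]; rfl
      have h2 : (mo.1 : E4 ≃L[ℝ] E4).symm (L (E4.basisVector 0)) = E4.basisVector 0 :=
        (mo.1 : E4 ≃L[ℝ] E4).symm_apply_apply _
      rw [h1, map_zero] at h2
      have h3 := congrArg (fun v : E4 ↦ v 0) h2
      simp [E4.basisVector] at h3
    · exact hpos
  refine ⟨β / ‖L‖ ^ 2, by positivity, fun y hylo hyhi v ↦ ?_⟩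
  have hcoer := hK (poincareInv mo.1 mo.2 y) hylo hyhi (Li v)
  -- `‖v‖ ≤ ‖L‖ ‖Λ⁻¹ v‖`
  have hv : ‖v‖ ≤ ‖L‖ * ‖Li v‖ := by
    have : v = L (Li v) := ((mo.1 : E4 ≃L[ℝ] E4).apply_symm_apply v).symm
    calc ‖v‖ = ‖L (Li v)‖ := by rw [← this]
      _ ≤ ‖L‖ * ‖Li v‖ := L.le_opNorm _
  -- `‖K‖ ≤ ‖K ∘ Λ⁻¹‖ ‖L‖` for the covector `K = g_{M,a}(P y)(Λ⁻¹ v)`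
  set K : E4 →L[ℝ] ℝ := Kerr.bilin M a (poincareInv mo.1 mo.2 y) (Li v) with hKdef
  have hKc : ‖K‖ ≤ ‖K.comp Li‖ * ‖L‖ := by
    have hKeq : K = (K.comp Li).comp L := by
      ext w
      simp only [ContinuousLinearMap.comp_apply, hLi, hL, ContinuousLinearEquiv.coe_coe,
        ContinuousLinearEquiv.symm_apply_apply]
    calc ‖K‖ = ‖(K.comp Li).comp L‖ := by rw [← hKeq]
      _ ≤ ‖K.comp Li‖ * ‖L‖ := ContinuousLinearMap.opNorm_comp_le _ _
  have hb : boostedKerrBilin mo.1 mo.2 M a y v = K.comp Li := crush_boostedKerrBilin_apply_eq_comp mo M a y v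
  rw [hb]
  -- assemble: `β‖v‖ ≤ β‖L‖‖Li v‖ ≤ ‖L‖‖K‖ ≤ ‖L‖² ‖K ∘ Li‖`
  have h1 : β * ‖v‖ ≤ ‖L‖ * ‖K‖ := by
    calc β * ‖v‖ ≤ β * (‖L‖ * ‖Li v‖) := mul_le_mul_of_nonneg_left hv hβ.le
      _ = ‖L‖ * (β * ‖Li v‖) := by ring
      _ ≤ ‖L‖ * ‖K‖ := mul_le_mul_of_nonneg_left hcoer (norm_nonneg _)
  have h2 : ‖L‖ * ‖K‖ ≤ ‖L‖ ^ 2 * ‖K.comp Li‖ := by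
    calc ‖L‖ * ‖K‖ ≤ ‖L‖ * (‖K.comp Li‖ * ‖L‖) := mul_le_mul_of_nonneg_left hKc (norm_nonneg _)
      _ = ‖L‖ ^ 2 * ‖K.comp Li‖ := by ring
  have hL2 : 0 < ‖L‖ ^ 2 := by positivity
  rw [div_mul_eq_mul_div, div_le_iff₀ hL2]
  linarith

/-! ### The registered sub-goal: `η`-good interior charts are immersions on the late shell -/

/-- **An `η`-good interior chart is an immersion on its late shell, for `η ≤ η₁(M, a, δ, mo)`** (registered
sub-goal `stub_crushChartImmersion` of crux `SettledCapture`, line `null-concave-crush`, brick of stub 3a): there is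
`0 < η₁ < ⊤` such that for every development `𝒟` and every interior chart `Φ` from the boosted ingoing-Kerr
background which is `η`-good on the late shell `{t* > T, r₋ + δ/2 < r < r₊}` with `η ≤ η₁`, at every shell point the
metric deviation `Φ^*g − g_B` has norm `≤ η.toReal` (from `supCkENorm ≤ η`, order `0`) and the differential `dΦ` is
injective (`‖Φ^*g − g_B‖ ≤ β/2 < β` against the coercivity constant `β` of `g_B` on the band
`r₋ + δ/2 ≤ r ≤ r₊`). [folklore] -/
theorem stub_crushChartImmersion : ∀ (M a δ : ℝ) (mo : lorentzGroup × E4), 0 < M → |a| < M → 0 < δ → ∃ η₁ : ℝ≥0∞, 0 < η₁ ∧ η₁ < ⊤ ∧ ∀ (X : Type) [TopologicalSpace X] [ChartedSpace E3 X] [IsManifold (𝓡 3) ((⊤ : ℕ∞) : WithTop ℕ∞) X] [T2Space X] [SecondCountableTopology X] [ConnectedSpace X] (D : InitialDataSet (𝓡 3) X) (𝒟 : VacuumCauchyDevelopment D) (Φ : (interiorBackground mo M a (Kerr.rMinus M a)).domain → 𝒟.carrier) (T : ℝ) (η : ℝ≥0∞), η ≤ η₁ → IsGoodInteriorChart 𝒟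 mo M a Φ T (Kerr.rMinus M a + δ / 2) (Kerr.rPlus M a) η → ∀ x ∈ lateShell (interiorBackground mo M a (Kerr.rMinus M a)) T (Kerr.rMinus M a + δ / 2) (Kerr.rPlus M a), ‖𝒟.toSpacetime.deviation (interiorBackground mo M a (Kerr.rMinus M a)) Φ x‖ ≤ η.toReal ∧ Function.Injective (mfderiv 𝓘(ℝ, E4) (𝓡 4) Φ x) := by
  intro M a δ mo hM ha hδ
  have hr₀ : 0 < Kerr.rMinus M a + δ / 2 := by
    have := Kerr.IsSubextremal.rMinus_nonneg ha; linarith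
  by_cases hband : Kerr.rMinus M a + δ / 2 ≤ Kerr.rPlus M a
  · obtain ⟨β, hβ, hcoer⟩ := crush_boostedKerr_coercive M a mo hr₀ hband
    refine ⟨ENNReal.ofReal (β / 2), ENNReal.ofReal_pos.2 (by positivity), ENNReal.ofReal_lt_top, ?_⟩
    intro X _ _ _ _ _ _ D 𝒟 Φ T η hη hgood x hx
    obtain ⟨-, -, -, -, hsup⟩ := hgood
    have hηtop : η ≠ ⊤ := ne_top_of_le_ne_top ENNReal.ofReal_ne_top hη
    -- order-0 readout of `supCkENorm ≤ η` at the shell point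
    have hle := (enorm_iteratedFDeriv_le_supCkENorm (k := 1) (m := 0) (Nat.zero_le _)
      (mem_image_of_mem Subtype.val hx)
      (𝒟.toSpacetime.deviationExtend (interiorBackground mo M a (Kerr.rMinus M a)) Φ)).trans hsup
    have hdev : ‖𝒟.toSpacetime.deviation (interiorBackground mo M a (Kerr.rMinus M a)) Φ x‖ ≤ η.toReal := by
      have h1 : ‖iteratedFDeriv ℝ 0
          (𝒟.toSpacetime.deviationExtend (interiorBackground mo M a (Kerr.rMinus M a)) Φ) x.1‖ ≤ η.toReal := by
        rw [← toReal_enorm]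
        exact ENNReal.toReal_mono hηtop hle
      rwa [norm_iteratedFDeriv_zero, Spacetime.deviationExtend_coe] at h1
    refine ⟨hdev, ?_⟩
    -- closeness to the coercive boosted form at `x`
    have hβ2 : η.toReal ≤ β / 2 := ENNReal.toReal_le_of_le_ofReal (by positivity) hη
    have hclose : ‖(show E4 →L[ℝ] E4 →L[ℝ] ℝ from
        pullbackBilin (I := 𝓡 4) (I' := 𝓘(ℝ, E4)) Φ 𝒟.metric.val x) - boostedKerrBilin mo.1 mo.2 M a x.1‖ < β := by
      have : 𝒟.toSpacetime.deviation (interiorBackground mo M a (Kerr.rMinus M a)) Φ x =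
          (show E4 →L[ℝ] E4 →L[ℝ] ℝ from pullbackBilin (I := 𝓡 4) (I' := 𝓘(ℝ, E4)) Φ 𝒟.metric.val x) -
            boostedKerrBilin mo.1 mo.2 M a x.1 := rfl
      rw [← this]
      linarith
    have hxlo : Kerr.rMinus M a + δ / 2 ≤ Kerr.radius a (poincareInv mo.1 mo.2 x.1) := hx.2.1.le
    have hxhi : Kerr.radius a (poincareInv mo.1 mo.2 x.1) ≤ Kerr.rPlus M a := hx.2.2.le
    refine (injective_iff_map_eq_zero _).2 fun v hv ↦
      injClose_nondegenerate_of_norm_sub_lt (hcoer x.1 hxlo hxhi) hclose v fun w ↦ ?_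
    change 𝒟.metric.val (Φ x) (mfderiv 𝓘(ℝ, E4) (𝓡 4) Φ x v) (mfderiv 𝓘(ℝ, E4) (𝓡 4) Φ x w) = 0
    rw [hv, map_zero, _root_.zero_apply]
  · -- empty shell: any `η₁` works vacuously
    refine ⟨1, one_pos, ENNReal.one_lt_top, ?_⟩
    intro X _ _ _ _ _ _ D 𝒟 Φ T η hη hgood x hx
    exfalso
    exact hband (hx.2.1.le.trans hx.2.2.le)

end Summit.FinalStateConjecture.FinalStateConjecture.Theorems.BartnikGapSettling.SettledCapture

end
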